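import Summits.CriticalPhenomena.CardyFormulaZ2.Theorems.CardyMagicRigidityNestingRigidityBigLoopsExpMomentBK
import HarnessLib

/-!
# Crux `NestingRigidity`, line `positive-cone-weight-doubling`: keystone K6 on bond-`ℤ²` —
# all-order exponential moments of the number of big loops in a window, uniformly in the mesh

Crux `Summit.CriticalPhenomena.CardyFormulaZ2.Theses.CardyMagicRigidity.NestingRigidity`
(stmt-CriticalPhenomena-4835), line `positive-cone-weight-doubling`, keystone stub K6
`expMoment_ncard_bigLoops_le`: `E_δ[exp(s N)] ≤ C(s, R, η)` for
`N = #{u ∈ X_δ : trace u ⊆ B(0, R), diam (trace u) ≥ η}`, all `0 < δ ≤ η/c₀(s, R, η)`.  This file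
proves the bond-`ℤ²` half (anchor `expMoment_ncard_bigLoops_le_zEns`), with no cited fact and no
definition:

* §1 **summation** (`BigLoopsExp.integral_exp_le_of_jointTails`, pure measure theory): if a
  statistic `N ≤ ∑ i f₁ i + ∑ i f₀ i` is dominated by the sizes of two "patterns" `f₁ f₀ : Fin B → ℕ`
  (`≤ M` pointwise) whose pattern events have joint geometric tails `P(EV f) ≤ p^{∑ f}`, then
  `E[exp(t N)] ≤ 2 · 2^B` as soon as `e^{2t} p ≤ 1/2` — expand
  `∏ i ∑_{m ≤ M} (e^{2t} p)^m = ∑_f ∏ i (e^{2t} p)^{f i}` (`Finset.prod_univ_sum`);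
* §2 **the bond-`ℤ²` half**: cover `B̄(0, R)` by `B ≤ 81 (R/r)²` discs `B̄(c i, r)` of radius
  `r = (η/16) (e^{-2t}/2)^{1/α}` (`t = max s 0`, `α` the RSW exponent of
  `annulusOpenCrossing_half_le_holds`); a big loop meets a first disc `i` and leaves `B(c i, η/4)`;
  the patterns `f₁ i`, `f₀ i` = numbers of counter-clockwise / clockwise big loops whose first disc
  is `i` put `ω` (resp. `dualConfig ω`) in the joint disjoint occurrence of
  `(annulusOpenCrossing · δ (r + δ) (η/4 - δ))^{□ f i}` over all discs (`…BigLoopsExpMomentBK`), of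
  probability `≤ ∏ i p^{f i}` by iterated BK–Reimer (`BigLoopsExp.measureReal_foldr_ofFn_le_prod`,
  `reimer_holds`), the RSW bound `p = (16 r/η)^α = e^{-2t}/2` and self-duality
  (`measure_preimage_dualConfig_le`); whence `E[e^{sN}] ≤ 2 · 2^{81 (R/r)²}`.
-/

noncomputable section

open MeasureTheory Set Filter Metric
open scoped Real Topology BigOperators ENNReal

namespace Summit.CriticalPhenomena.CardyFormulaZ2.Cruxes.NestingRigidity.PositiveConeWeightDoubling

open Literature.Probability.RandomPlanarGeometry Literature.Probability.Percolation
  Literature.Probability.LatticeModels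
open Literature.Probability.Percolation.SSContinuity (measure_preimage_dualConfig_le)
open Summit.CriticalPhenomena.CardyFormulaZ2.Cruxes.NestingRigidity.RingCloudTomography

namespace BigLoopsExp

/-! ## §1 Summation: exponential moments from joint geometric tails of pattern events -/

/-- A finite geometric sum with ratio `≤ 1/2` is at most `2`. -/
theorem geom_sum_range_le_two {x : ℝ} (h0 : 0 ≤ x) (h : x ≤ 1 / 2) (n : ℕ) :
    ∑ m ∈ Finset.range n, x ^ m ≤ 2 := by
  have := geom_sum_Ico_le_of_lt_one (m := 0) (n := n) h0 (by linarith)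
  rw [pow_zero, ← Finset.range_eq_Ico] at this
  have h2 : 1 / (1 - x) ≤ 2 := by rw [div_le_iff₀ (by linarith)]; linarith
  linarith

/-- **The pattern sum**: `∑_{f ≤ M} (∏ i q^{f i}) P(EV f) ≤ 2^B` when `P(EV f) ≤ p^{∑ f}` and
`q p ≤ 1/2` (`q, p ≥ 0`): the left side is `≤ ∑_f ∏ i (q p)^{f i} = ∏ i ∑_{m ≤ M} (q p)^m`. -/
theorem sum_pattern_le {Ω : Type*} [MeasurableSpace Ω] (P : Measure Ω) {q p : ℝ} (hq : 0 ≤ q)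
    (hp : 0 ≤ p) (hqp : q * p ≤ 1 / 2) {B M : ℕ} (EV : (Fin B → ℕ) → Set Ω)
    (hP : ∀ f, P.real (EV f) ≤ p ^ (∑ i, f i)) :
    ∑ f ∈ Fintype.piFinset (fun _ : Fin B ↦ Finset.range (M + 1)),
      (∏ i, q ^ (f i)) * P.real (EV f) ≤ 2 ^ B := by
  classical
  calc ∑ f ∈ Fintype.piFinset (fun _ : Fin B ↦ Finset.range (M + 1)), (∏ i, q ^ (f i)) * P.real (EV f)
      ≤ ∑ f ∈ Fintype.piFinset (fun _ : Fin B ↦ Finset.range (M + 1)), ∏ i, (q * p) ^ (f i) := by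
        refine Finset.sum_le_sum fun f _ ↦ ?_
        calc (∏ i, q ^ (f i)) * P.real (EV f) ≤ (∏ i, q ^ (f i)) * p ^ (∑ i, f i) :=
              mul_le_mul_of_nonneg_left (hP f) (Finset.prod_nonneg fun i _ ↦ pow_nonneg hq _)
          _ = ∏ i, (q * p) ^ (f i) := by
              rw [← Finset.prod_pow_eq_pow_sum, ← Finset.prod_mul_distrib]
              exact Finset.prod_congr rfl fun i _ ↦ (mul_pow q p (f i)).symm
    _ = ∏ _i : Fin B, ∑ m ∈ Finset.range (M + 1), (q * p) ^ m :=
        (Finset.prod_univ_sum (fun _ : Fin B ↦ Finset.range (M + 1)) (fun _ m ↦ (q * p) ^ m)).symm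
    _ ≤ ∏ _i : Fin B, (2 : ℝ) :=
        Finset.prod_le_prod (fun i _ ↦ Finset.sum_nonneg fun m _ ↦ pow_nonneg (mul_nonneg hq hp) _)
          fun i _ ↦ geom_sum_range_le_two (mul_nonneg hq hp) hqp _
    _ = 2 ^ B := by simp

/-- **Exponential moments from joint geometric tails.**  On a probability space, let the
`ℕ`-valued statistic `N` satisfy, almost surely, `N ≤ ∑ i f₁ i + ∑ i f₀ i` for two patterns
`f₁ f₀ : Fin B → ℕ` bounded by `M` with `ω ∈ EV₁ f₁ ∩ EV₀ f₀`, where the measurable pattern events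
have the joint geometric tails `P(EV₁ f), P(EV₀ f) ≤ p^{∑ i f i}`.  If `0 ≤ t`, `0 ≤ p` and
`e^{2t} p ≤ 1/2`, then `E[exp(t N)] ≤ 2 · 2^B`: pointwise
`e^{tN} ≤ e^{2t ∑ f₁} + e^{2t ∑ f₀} ≤ G₁ + G₀` with `G_• = ∑_f (∏ i e^{2t f i}) 1_{EV_• f}`, and
`E[G_•] ≤ 2^B` by `sum_pattern_le`. -/
theorem integral_exp_le_of_jointTails {Ω : Type*} [MeasurableSpace Ω] (P : Measure Ω)
    [IsProbabilityMeasure P] {t p : ℝ} (ht : 0 ≤ t) (hp : 0 ≤ p)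
    (hq : Real.exp (2 * t) * p ≤ 1 / 2) {B M : ℕ} (EV₁ EV₀ : (Fin B → ℕ) → Set Ω)
    (hm₁ : ∀ f, MeasurableSet (EV₁ f)) (hm₀ : ∀ f, MeasurableSet (EV₀ f))
    (hP₁ : ∀ f, P.real (EV₁ f) ≤ p ^ (∑ i, f i)) (hP₀ : ∀ f, P.real (EV₀ f) ≤ p ^ (∑ i, f i))
    {N : Ω → ℕ} (hN : Integrable (fun ω ↦ Real.exp (t * N ω)) P)
    (hdom : ∀ᵐ ω ∂P, ∃ f₁ f₀ : Fin B → ℕ, (∀ i, f₁ i ≤ M) ∧ (∀ i, f₀ i ≤ M) ∧ ω ∈ EV₁ f₁ ∧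
      ω ∈ EV₀ f₀ ∧ N ω ≤ ∑ i, f₁ i + ∑ i, f₀ i) :
    ∫ ω, Real.exp (t * N ω) ∂P ≤ 2 * 2 ^ B := by
  classical
  set q : ℝ := Real.exp (2 * t) with hq_def
  have hq0 : 0 ≤ q := (Real.exp_pos _).le
  set Φ : Finset (Fin B → ℕ) := Fintype.piFinset fun _ : Fin B ↦ Finset.range (M + 1) with hΦ
  -- the dominating functions
  set G : ((Fin B → ℕ) → Set Ω) → Ω → ℝ := fun EV ω ↦
    ∑ f ∈ Φ, (∏ i, q ^ (f i)) * (EV f).indicator (fun _ ↦ (1 : ℝ)) ω with hG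
  have hGint : ∀ EV : (Fin B → ℕ) → Set Ω, (∀ f, MeasurableSet (EV f)) → Integrable (G EV) P :=
    fun EV hEV ↦ integrable_finsetSum _ fun f _ ↦ ((integrable_const _).indicator (hEV f)).const_mul _
  have hGI : ∀ EV : (Fin B → ℕ) → Set Ω, (∀ f, MeasurableSet (EV f)) →
      (∀ f, P.real (EV f) ≤ p ^ (∑ i, f i)) → ∫ ω, G EV ω ∂P ≤ 2 ^ B := by
    intro EV hEV hPEV
    have : ∫ ω, G EV ω ∂P = ∑ f ∈ Φ, (∏ i, q ^ (f i)) * P.real (EV f) := by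
      rw [hG]
      dsimp only
      rw [integral_finsetSum _ fun f _ ↦ ((integrable_const _).indicator (hEV f)).const_mul _]
      refine Finset.sum_congr rfl fun f _ ↦ ?_
      rw [integral_const_mul, integral_indicator_const _ (hEV f), smul_eq_mul, mul_one]
    rw [this]
    exact sum_pattern_le P hq0 hp hq EV hPEV
  -- a member pattern is dominated by its term
  have hterm : ∀ (EV : (Fin B → ℕ) → Set Ω) (ω : Ω) (f : Fin B → ℕ), (∀ i, f i ≤ M) → ω ∈ EV f →
      q ^ (∑ i, f i) ≤ G EV ω := by
    intro EV ω f hfM hmem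
    have hfΦ : f ∈ Φ := Fintype.mem_piFinset.2 fun i ↦ Finset.mem_range.2 (Nat.lt_succ_of_le (hfM i))
    calc q ^ (∑ i, f i) = (∏ i, q ^ (f i)) * (EV f).indicator (fun _ ↦ (1 : ℝ)) ω := by
          rw [Finset.prod_pow_eq_pow_sum, Set.indicator_of_mem hmem, mul_one]
      _ ≤ G EV ω := by
          refine Finset.single_le_sum (f := fun f ↦ (∏ i, q ^ (f i)) *
            (EV f).indicator (fun _ ↦ (1 : ℝ)) ω) (fun f _ ↦ ?_) hfΦ
          exact mul_nonneg (Finset.prod_nonneg fun i _ ↦ pow_nonneg hq0 _)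
            (Set.indicator_nonneg (fun _ _ ↦ zero_le_one) _)
  -- pointwise domination
  have hle : ∀ᵐ ω ∂P, Real.exp (t * N ω) ≤ G EV₁ ω + G EV₀ ω := by
    filter_upwards [hdom] with ω ⟨f₁, f₀, hf₁, hf₀, h₁, h₀, hNle⟩
    have h2 : N ω ≤ 2 * max (∑ i, f₁ i) (∑ i, f₀ i) := by omega
    calc Real.exp (t * N ω) ≤ Real.exp ((max (∑ i, f₁ i) (∑ i, f₀ i) : ℕ) * (2 * t)) := by
          refine Real.exp_le_exp.2 ?_
          have : (N ω : ℝ) ≤ 2 * (max (∑ i, f₁ i) (∑ i, f₀ i) : ℕ) := by exact_mod_cast h2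
          nlinarith
      _ = q ^ (max (∑ i, f₁ i) (∑ i, f₀ i)) := Real.exp_nat_mul _ _
      _ ≤ q ^ (∑ i, f₁ i) + q ^ (∑ i, f₀ i) := by
          rcases max_cases (∑ i, f₁ i) (∑ i, f₀ i) with ⟨h, -⟩ | ⟨h, -⟩ <;> rw [h] <;>
            linarith [pow_nonneg hq0 (∑ i, f₁ i), pow_nonneg hq0 (∑ i, f₀ i)]
      _ ≤ G EV₁ ω + G EV₀ ω := add_le_add (hterm EV₁ ω f₁ hf₁ h₁) (hterm EV₀ ω f₀ hf₀ h₀)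
  calc ∫ ω, Real.exp (t * N ω) ∂P ≤ ∫ ω, (G EV₁ ω + G EV₀ ω) ∂P :=
        integral_mono_ae hN ((hGint EV₁ hm₁).add (hGint EV₀ hm₀)) hle
    _ = ∫ ω, G EV₁ ω ∂P + ∫ ω, G EV₀ ω ∂P := integral_add (hGint EV₁ hm₁) (hGint EV₀ hm₀)
    _ ≤ 2 ^ B + 2 ^ B := add_le_add (hGI EV₁ hm₁ hP₁) (hGI EV₀ hm₀ hP₀)
    _ = 2 * 2 ^ B := by ring

/-- **The first index of a finite family of properties that holds.** -/
theorem exists_first {B : ℕ} (q : Fin B → Prop) (h : ∃ i, q i) : ∃ i, q i ∧ ∀ j < i, ¬ q j := by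
  classical
  obtain ⟨i₀, hi₀⟩ := h
  obtain ⟨i, hi, hmin⟩ := (Finset.univ.filter q).exists_min_image id ⟨i₀, by simp [hi₀]⟩
  simp only [Finset.mem_filter, Finset.mem_univ, true_and, id] at hi hmin
  exact ⟨i, hi, fun j hj hqj ↦ absurd (hmin j hqj) (not_le.2 hj)⟩

end BigLoopsExp

/-! ## §2 The bond-`ℤ²` half of K6 -/

/-- **K6 on bond-`ℤ²`: all-order exponential moments of the number of big loops in a window,
uniformly in the mesh.**  For all `s R η` with `0 < η ≤ R` there are `C, c₀ > 0` such that for every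
mesh `0 < δ` with `c₀ δ ≤ η`, the number `N` of loops of `zEns.X δ = bondLoopConfig δ 0` with trace in
`B(0, R)` and diameter `≥ η` has `E[exp(s N)] ≤ C` (integrability included).  Proof: §2 of the
module docstring — thin covering, first-disc patterns, the joint disjoint occurrence of
`…BigLoopsExpMomentBK`, iterated BK–Reimer, RSW, self-duality, and the summation
`BigLoopsExp.integral_exp_le_of_jointTails`; `C = 2 · 2^{81 (R/r)²}`, `r = (η/16)(e^{-2 max(s,0)}/2)^{1/α}`,
`c₀ = max(c₁, 8) η / r`. -/
theorem expMoment_ncard_bigLoops_le_zEns : ∀ (s R η : ℝ), 0 < η → η ≤ R → ∃ C c₀ : ℝ, 0 < C ∧ 0 < c₀ ∧ ∀ δ : ℝ, 0 < δ → c₀ * δ ≤ η → Integrable (fun ω ↦ Real.exp (s * ({u ∈ (zEns.X δ ω).loops | u.range ⊆ Metric.ball (0 : ℂ) R ∧ η ≤ Metric.diam u.range}.ncard : ℝ))) zEns.P ∧ ∫ ω, Real.exp (s * ({u ∈ (zEns.X δ ω).loops | u.range ⊆ Metric.ball (0 : ℂ) R ∧ η ≤ Metric.diam u.range}.ncard :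 ℝ)) ∂zEns.P ≤ C := by
  classical
  intro s R η hη hηR
  haveI : IsProbabilityMeasure zEns.P := isProbabilityMeasure_of_mem zEns_mem
  obtain ⟨α, c₁, hα, hc₁, hbd⟩ := annulusOpenCrossing_half_le_holds
  -- the order `t ≥ 0`, the tail parameter `p`, the disc radius `r`
  set t : ℝ := max s 0 with ht_def
  have ht0 : 0 ≤ t := le_max_right _ _
  have hst : s ≤ t := le_max_left _ _
  set p : ℝ := Real.exp (-(2 * t)) / 2 with hp_def
  have hp0 : 0 < p := by positivity
  have hp1 : p ≤ 1 := by
    have : Real.exp (-(2 * t)) ≤ 1 := Real.exp_le_one_iff.2 (by linarith)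
    rw [hp_def]; linarith
  have hqp : Real.exp (2 * t) * p ≤ 1 / 2 := by
    rw [hp_def, ← mul_div_assoc, ← Real.exp_add, add_neg_cancel, Real.exp_zero]
  set r : ℝ := η / 16 * p ^ (1 / α) with hr_def
  have hpα : p ^ (1 / α) ≤ 1 := Real.rpow_le_one hp0.le hp1 (by positivity)
  have hr0 : 0 < r := by positivity
  have hrη : r ≤ η / 16 := by rw [hr_def]; exact mul_le_of_le_one_right (by positivity) hpα
  have hrR : r ≤ R := by linarith
  have hkey : (16 * r / η) ^ α = p := by
    have h16 : 16 * r / η = p ^ (1 / α) := by rw [hr_def]; field_simp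
    rw [h16, ← Real.rpow_mul hp0.le, one_div_mul_cancel hα.ne', Real.rpow_one]
  -- the cover of `B̄(0, R)` by `B ≤ 81 (R/r)²` discs of radius `r`
  obtain ⟨S, hScard, hcover⟩ := BigLoops.exists_cover_closedBall hr0 hrR
  set B : ℕ := S.card with hB
  set c : Fin B → ℂ := fun i ↦ (r : ℂ) * ((S.equivFin.symm i : S) : ℂ) with hc
  have hcov : ∀ z ∈ closedBall (0 : ℂ) R, ∃ i, z ∈ closedBall (c i) r := by
    intro z hz
    obtain ⟨y, hy, hzy⟩ := mem_iUnion₂.1 (hcover hz)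
    refine ⟨S.equivFin ⟨y, hy⟩, ?_⟩
    rw [hc]
    dsimp only
    rw [Equiv.symm_apply_apply]
    exact hzy
  -- the constants
  set κ : ℝ := max c₁ 8 with hκ
  have hκ8 : 8 ≤ κ := le_max_right _ _
  have hκc : c₁ ≤ κ := le_max_left _ _
  have hBC : (2 : ℝ) * 2 ^ B ≤ 2 * (2 : ℝ) ^ (81 * (R / r) ^ 2) := by
    refine mul_le_mul_of_nonneg_left ?_ (by norm_num)
    rw [← Real.rpow_natCast]
    exact Real.rpow_le_rpow_of_exponent_le (by norm_num) hScard
  refine ⟨2 * (2 : ℝ) ^ (81 * (R / r) ^ 2), κ * η / r, by positivity, by positivity,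
    fun δ hδ hδη ↦ ?_⟩
  -- mesh conditions
  have hκδ : κ * δ ≤ r := by
    rw [div_mul_eq_mul_div, div_le_iff₀ hr0] at hδη
    exact le_of_mul_le_mul_right (by linarith) hη
  have hδr : 8 * δ ≤ r := le_trans (mul_le_mul_of_nonneg_right hκ8 hδ.le) hκδ
  have hc₁δ : c₁ * δ ≤ r := le_trans (mul_le_mul_of_nonneg_right hκc hδ.le) hκδ
  have hab : r + 2 * δ ≤ η / 4 := by linarith
  have hratio : (r + δ) / (η / 4 - δ) ≤ 16 * r / η := by
    rw [div_le_div_iff₀ (by linarith) hη]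
    nlinarith [mul_le_mul_of_nonneg_right hδr hη.le,
      mul_le_mul_of_nonneg_left hδr (by positivity : (0 : ℝ) ≤ 2 * r),
      mul_le_mul_of_nonneg_left hrη (by positivity : (0 : ℝ) ≤ 2 * r), mul_pos hr0 hη]
  have hpA : ∀ x : ℂ, (bondPercolation (zdGraph 2) half).real
      (annulusOpenCrossing x δ (r + δ) (η / 4 - δ)) ≤ p := by
    intro x
    refine (hbd x δ (r + δ) (η / 4 - δ) hδ (by linarith) (by linarith)).trans ?_
    rw [← hkey]
    exact Real.rpow_le_rpow (div_nonneg (by linarith) (by linarith)) hratio hα.le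
  -- the statistic: measurability, boundedness, integrability
  set big : UnbasedLoop ℂ → Prop := fun u ↦ u.range ⊆ Metric.ball (0 : ℂ) R ∧ η ≤ Metric.diam u.range
    with hbig
  obtain ⟨Mb, hMb⟩ := BigLoops.exists_ncard_loops_sep_le zEns zEns_mem hδ R
  have hmeasN : Measurable fun ω ↦ ({u ∈ (zEns.X δ ω).loops | big u}.ncard : ℝ) :=
    measurable_from_nat.comp (BigLoops.measurable_ncard_loops_sep zEns zEns_mem δ big)
  have hint : ∀ a : ℝ, Integrable
      (fun ω ↦ Real.exp (a * ({u ∈ (zEns.X δ ω).loops | big u}.ncard : ℝ))) zEns.P := by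
    intro a
    refine Integrable.of_bound (Real.measurable_exp.comp (hmeasN.const_mul a)).aestronglyMeasurable
      (Real.exp (|a| * Mb)) (Eventually.of_forall fun ω ↦ ?_)
    rw [Real.norm_eq_abs, Real.abs_exp]
    refine Real.exp_le_exp.2 ?_
    have h1 : ({u ∈ (zEns.X δ ω).loops | big u}.ncard : ℝ) ≤ Mb := by
      exact_mod_cast (hMb big (fun u h ↦ h.1) ω).2
    have h2 : (0 : ℝ) ≤ ({u ∈ (zEns.X δ ω).loops | big u}.ncard : ℝ) := Nat.cast_nonneg _
    calc a * ({u ∈ (zEns.X δ ω).loops | big u}.ncard : ℝ)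
        ≤ |a| * ({u ∈ (zEns.X δ ω).loops | big u}.ncard : ℝ) :=
          mul_le_mul_of_nonneg_right (le_abs_self a) h2
      _ ≤ |a| * Mb := mul_le_mul_of_nonneg_left h1 (abs_nonneg a)
  refine ⟨hint s, ?_⟩
  -- reduce to the order `t`
  have hmono : ∫ ω, Real.exp (s * ({u ∈ (zEns.X δ ω).loops | big u}.ncard : ℝ)) ∂zEns.P ≤
      ∫ ω, Real.exp (t * ({u ∈ (zEns.X δ ω).loops | big u}.ncard : ℝ)) ∂zEns.P :=
    integral_mono (hint s) (hint t) fun ω ↦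
      Real.exp_le_exp.2 (mul_le_mul_of_nonneg_right hst (Nat.cast_nonneg _))
  refine hmono.trans (le_trans ?_ hBC)
  -- the pattern events
  set A₁ : Fin B → Set (BondConfig (Site 2)) := fun i ↦
    annulusOpenCrossing (c i) δ (r + δ) (η / 4 - δ) with hA₁
  set A₀ : Fin B → Set (BondConfig (Site 2)) := fun i ↦
    annulusOpenCrossing (c i - δ * (1 + Complex.I) / 2) δ (r + δ) (η / 4 - δ) with hA₀
  set EV₁ : (Fin B → ℕ) → Set (BondConfig (Site 2)) := fun f ↦
    (List.ofFn fun i ↦ disjointOccurrencePow (A₁ i) (f i)).foldr disjointOccurrence univ with hEV₁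
  set EV₀ : (Fin B → ℕ) → Set (BondConfig (Site 2)) := fun f ↦ dualConfig ⁻¹'
    (List.ofFn fun i ↦ disjointOccurrencePow (A₀ i) (f i)).foldr disjointOccurrence univ with hEV₀
  -- common determining finite sets of edges
  have hdet : ∀ y : ℂ, ∃ F : Finset (Sym2 (Site 2)),
      DeterminedBy (annulusOpenCrossing y δ (r + δ) (η / 4 - δ)) ↑F :=
    fun y ↦ ⟨_, determinedBy_annulusOpenCrossing hδ y _ _⟩
  choose Fd hFd using hdet
  set F₁ : Finset (Sym2 (Site 2)) := Finset.univ.biUnion fun i ↦ Fd (c i) with hF₁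
  set F₀ : Finset (Sym2 (Site 2)) := Finset.univ.biUnion fun i ↦ Fd (c i - δ * (1 + Complex.I) / 2)
    with hF₀
  have hA₁F : ∀ i, DeterminedBy (A₁ i) ↑F₁ := fun i ↦ (hFd (c i)).mono fun e he ↦ by
    rw [hF₁, Finset.coe_biUnion]
    exact mem_iUnion₂.2 ⟨i, Finset.mem_coe.2 (Finset.mem_univ i), he⟩
  have hA₀F : ∀ i, DeterminedBy (A₀ i) ↑F₀ := fun i ↦
    (hFd (c i - δ * (1 + Complex.I) / 2)).mono fun e he ↦ by
      rw [hF₀, Finset.coe_biUnion]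
      exact mem_iUnion₂.2 ⟨i, Finset.mem_coe.2 (Finset.mem_univ i), he⟩
  -- BK–Reimer
  have hBK : ∀ (F : Finset (Sym2 (Site 2))) (A A' : Set (BondConfig (Site 2))), IsUpperSet A →
      IsUpperSet A' → DeterminedBy A ↑F → DeterminedBy A' ↑F →
      (bondPercolation (zdGraph 2) half).real (A □ A') ≤
        (bondPercolation (zdGraph 2) half).real A * (bondPercolation (zdGraph 2) half).real A' :=
    fun F A A' _ _ hA hA' ↦ reimer_holds (zdGraph 2) half ⟨F, hA⟩ ⟨F, hA'⟩
  -- joint geometric tails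
  have htail : ∀ (A : Fin B → Set (BondConfig (Site 2))) (F : Finset (Sym2 (Site 2)))
      (f : Fin B → ℕ), (∀ i, IsUpperSet (A i)) → (∀ i, DeterminedBy (A i) ↑F) →
      (∀ i, (bondPercolation (zdGraph 2) half).real (A i) ≤ p) →
      (bondPercolation (zdGraph 2) half).real ((List.ofFn fun i ↦
        disjointOccurrencePow (A i) (f i)).foldr disjointOccurrence univ) ≤ p ^ (∑ i, f i) := by
    intro A F f hAu hAF hAp
    refine (BigLoopsExp.measureReal_foldr_ofFn_le_prod _ (hBK F) A f hAu hAF).trans ?_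
    rw [← Finset.prod_pow_eq_pow_sum]
    exact Finset.prod_le_prod (fun i _ ↦ pow_nonneg measureReal_nonneg _) fun i _ ↦
      pow_le_pow_left₀ measureReal_nonneg (hAp i) _
  have hP₁ : ∀ f, (bondPercolation (zdGraph 2) half).real (EV₁ f) ≤ p ^ (∑ i, f i) := fun f ↦
    htail A₁ F₁ f (fun i ↦ isUpperSet_annulusOpenCrossing _ δ _ _) hA₁F fun i ↦ hpA _
  have hP₀ : ∀ f, (bondPercolation (zdGraph 2) half).real (EV₀ f) ≤ p ^ (∑ i, f i) := fun f ↦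
    (ENNReal.toReal_mono (measure_ne_top _ _) (measure_preimage_dualConfig_le _)).trans
      (htail A₀ F₀ f (fun i ↦ isUpperSet_annulusOpenCrossing _ δ _ _) hA₀F fun i ↦ hpA _)
  have hm₁ : ∀ f, MeasurableSet (EV₁ f) := fun f ↦
    (BigLoopsExp.determinedBy_foldr (BigLoopsExp.determinedBy_of_mem_ofFn hA₁F f)).measurableSet_of_finset
  have hm₀ : ∀ f, MeasurableSet (EV₀ f) := fun f ↦ measurable_dualConfig
    (BigLoopsExp.determinedBy_foldr (BigLoopsExp.determinedBy_of_mem_ofFn hA₀F f)).measurableSet_of_finset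
  -- summation
  change ∫ ω, Real.exp (t * ({u ∈ (bondLoopConfig δ 0 ω).loops | big u}.ncard : ℝ))
    ∂(bondPercolation (zdGraph 2) half) ≤ 2 * 2 ^ B
  refine BigLoopsExp.integral_exp_le_of_jointTails (bondPercolation (zdGraph 2) half) ht0 hp0.le hqp
    EV₁ EV₀ hm₁ hm₀ hP₁ hP₀ (M := Mb)
    (N := fun ω ↦ {u ∈ (bondLoopConfig δ 0 ω).loops | big u}.ncard) (hint t) ?_
  -- the patterns, on lattice configurations
  filter_upwards [ae_subset_edgeSet (zdGraph 2) half] with ω hω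
  set meets : Fin B → UnbasedLoop ℂ → Prop := fun i u ↦ (u.range ∩ closedBall (c i) r).Nonempty
    with hmeets
  set T : Fin 2 → Fin B → Set (UnbasedLoop ℂ) := fun τ i ↦
    {u ∈ (bondLoopConfig δ 0 ω).F τ | big u ∧ (meets i u ∧ ∀ j < i, ¬ meets j u)} with hT
  have hBigfin : {u ∈ (bondLoopConfig δ 0 ω).loops | big u}.Finite := (hMb big (fun u h ↦ h.1) ω).1
  have hTsub : ∀ τ i, T τ i ⊆ {u ∈ (bondLoopConfig δ 0 ω).loops | big u} :=
    fun τ i u hu ↦ ⟨LoopConfig.subset_loops _ τ hu.1, hu.2.1⟩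
  have hTfin : ∀ τ i, (T τ i).Finite := fun τ i ↦ hBigfin.subset (hTsub τ i)
  have hTle : ∀ τ i, (T τ i).ncard ≤ Mb := fun τ i ↦
    (ncard_le_ncard (hTsub τ i) hBigfin).trans (hMb big (fun u h ↦ h.1) ω).2
  have hTdisj : ∀ τ, Pairwise fun i i' ↦ Disjoint (T τ i) (T τ i') := by
    intro τ i i' hii'
    rw [Set.disjoint_left]
    rintro u ⟨-, -, hfi⟩ ⟨-, -, hfi'⟩
    rcases lt_or_gt_of_ne hii' with h | h
    · exact hfi'.2 i h hfi.1
    · exact hfi.2 i' h hfi'.1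
  have hmeet : ∀ τ i, ∀ u ∈ T τ i, (u.range ∩ Metric.closedBall (c i) r).Nonempty ∧
      (u.range ∩ (Metric.ball (c i) (η / 4))ᶜ).Nonempty := by
    rintro τ i u ⟨-, ⟨-, hdiam⟩, hfi⟩
    refine ⟨hfi.1, ?_⟩
    by_contra hcon
    have hsub : u.range ⊆ ball (c i) (η / 4) := fun z hz ↦ by
      by_contra hz'
      exact hcon ⟨z, hz, hz'⟩
    have := (diam_mono hsub isBounded_ball).trans (diam_ball (by positivity : (0 : ℝ) ≤ η / 4))
    linarith
  refine ⟨fun i ↦ (T 1 i).ncard, fun i ↦ (T 0 i).ncard, hTle 1, hTle 0, ?_, ?_, ?_⟩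
  · exact BigLoopsExp.mem_foldr_of_typeOne_families hω hδ (a := fun _ ↦ r) (b := fun _ ↦ η / 4)
      (fun _ ↦ hab) c (T 1) (fun i u hu ↦ hu.1) (hTfin 1) (hTdisj 1) (hmeet 1) _ fun i ↦ le_rfl
  · exact BigLoopsExp.mem_foldr_dualConfig_of_typeZero_families hω hδ (a := fun _ ↦ r)
      (b := fun _ ↦ η / 4) (fun _ ↦ hab) c (T 0) (fun i u hu ↦ hu.1) (hTfin 0) (hTdisj 0)
      (hmeet 0) _ fun i ↦ le_rfl
  · -- every big loop has a type and a first disc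
    have hsub : {u ∈ (bondLoopConfig δ 0 ω).loops | big u} ⊆
        ⋃ i ∈ (Finset.univ : Finset (Fin B)), (T 1 i ∪ T 0 i) := by
      rintro u ⟨hu, hbu⟩
      obtain ⟨z, hz⟩ := u.range_nonempty
      obtain ⟨i₀, hi₀⟩ := hcov z (ball_subset_closedBall (hbu.1 hz))
      obtain ⟨i, hi, hmin⟩ := BigLoopsExp.exists_first (fun i ↦ meets i u) ⟨i₀, z, hz, hi₀⟩
      refine mem_iUnion₂.2 ⟨i, Finset.mem_univ _, ?_⟩
      rcases LoopConfig.mem_loops_iff.1 hu with h0 | h1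
      · exact Or.inr ⟨h0, hbu, hi, hmin⟩
      · exact Or.inl ⟨h1, hbu, hi, hmin⟩
    have hUfin : (⋃ i ∈ (Finset.univ : Finset (Fin B)), (T 1 i ∪ T 0 i)).Finite :=
      hBigfin.subset (iUnion₂_subset fun i _ ↦ union_subset (hTsub 1 i) (hTsub 0 i))
    calc {u ∈ (bondLoopConfig δ 0 ω).loops | big u}.ncard
        ≤ (⋃ i ∈ (Finset.univ : Finset (Fin B)), (T 1 i ∪ T 0 i)).ncard := ncard_le_ncard hsub hUfin
      _ ≤ ∑ i, (T 1 i ∪ T 0 i).ncard := Finset.set_ncard_biUnion_le _ _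
      _ ≤ ∑ i, ((T 1 i).ncard + (T 0 i).ncard) := Finset.sum_le_sum fun i _ ↦ ncard_union_le _ _
      _ = ∑ i, (T 1 i).ncard + ∑ i, (T 0 i).ncard := Finset.sum_add_distrib

end Summit.CriticalPhenomena.CardyFormulaZ2.Cruxes.NestingRigidity.PositiveConeWeightDoubling

end
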